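import Summits.QuantumFields.YangMills.Theorems.BalabanLadderNTWeakPackageCoverThreePoint
import Summits.QuantumFields.YangMills.Theorems.BalabanLadderNTBoundaryLawOscillation
import Summits.QuantumFields.YangMills.Theorems.BalabanLadderNTWeakPackageCollar
import HarnessLib

/-!
# Crux `NT` (stmt-QuantumFields-19353), stub `stub_cfpw : CFPW`: the clause (T) on sparse radii — registered form, geometric radii

Helper file (`--supports stmt-QuantumFields-19353`) of the fleet lead prover of crux `NT` (unit `ym-spine-19353-p1`,
g3); corollaries of `fc3Weak_of_cover` (`…NTWeakPackageCoverThreePoint`):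

* `fc3Weak_of_cover'` — the weak third-cumulant clause (T) of the registered stub `stub_cfpw : CFPW` (skeleton v3
  «weak-package» 374f16092bb0c203) in its LITERAL `∀ s₀`-collar form, from `FBL G r a` and the signed floor on the
  x-centred cubes of a `θ`-covering set of radii (via `fc3Weak_of_antitoneCollar`);
* `fc3Weak_of_seq` — the same along an unbounded sequence of radii with `R_{k+1} + 1 ≤ θ (R_k + 1)`, `θ ≥ 1` (the cube
  sizes of a multiscale expansion; `BoundaryLaw.cover_of_seq`).

With `BoundaryLaw.fbl_of_oscillation_seq` (E1) and `floorClause_of_seq` (E2′) this completes the statement: **the whole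
weak femto package of `Cruxes/NT/Lines/engine-target.md` — boundary law, two-point floor, signed third cumulant — need
only be established on the engine's own geometric sequence of cube sizes** (E1 as an exterior-to-exterior oscillation,
E2′/E3 with positive monotone shapes and antitone collars), constants `θ⁴ C₁`, `c₂/2`, `c₃/2`.
-/

set_option autoImplicit false

noncomputable section

open MeasureTheory Filter Topology
open Literature.MathematicalPhysics.QuantumFieldTheory Literature.MathematicalPhysics.QuantumLattice
open Literature.Probability.LatticeModels
open Summit.QuantumFields.YangMills.Cruxes.OSLegsFromFemtoAndGap.DlrCollarTransfer
open Summit.QuantumFields.YangMills.Cruxes.NT.BoundaryLaw (cover_of_seq)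

namespace Summit.QuantumFields.YangMills.Cruxes.NT.WeakPackage

section Lattice

variable (G : Type) [Group G] [TopologicalSpace G] [IsTopologicalGroup G] [CompactSpace G]
  [MeasurableSpace G] [BorelSpace G] (r : LatticeRep G) (a : ℝ → ℝ)

/-- **The weak third-cumulant clause (T), registered `∀ s₀` form, from the signed floor on a covering set of radii**
(given `FBL G r a`; `fc3Weak_of_cover` + `fc3Weak_of_antitoneCollar`). [folklore] -/
theorem fc3Weak_of_cover' (ha : ∀ β, 0 < a β) (hFBL : FBL G r a) (S : Set ℕ) (θ : ℝ) (hθ : 1 ≤ θ) (D : ℕ)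
    (hcover : ∀ R : ℕ, D ≤ R → ∃ R₀ ∈ S, R₀ ≤ R ∧ (R : ℝ) + 1 ≤ θ * ((R₀ : ℝ) + 1))
    (h : ∃ (v w : EuclideanSpace ℝ (Fin 4)) (σ δ : ℝ) (Γ₃ : ℝ → ℝ) (β₃ ℓ₃ c₃ : ℝ) (K₃ : ℝ → ℝ) (n₃ : ℕ),
      (σ = 1 ∨ σ = -1) ∧ 0 < δ ∧ 2 * δ < ‖v‖ ∧ 2 * δ < ‖w‖ ∧ 2 * δ < ‖v - w‖ ∧ 0 < ℓ₃ ∧ 0 < c₃ ∧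
      (∀ s, 1 ≤ K₃ s) ∧ AntitoneOn K₃ (Set.Ioi 0) ∧
      Tendsto (fun s : ℝ => s * K₃ s) (nhdsWithin 0 (Set.Ioi 0)) (nhds 0) ∧
      Tendsto (fun s : ℝ => Γ₃ s / s ^ 4) (nhdsWithin 0 (Set.Ioi 0)) atTop ∧
      (∀ s : ℝ, 0 < s → s ≤ ℓ₃ → 0 < Γ₃ s) ∧ MonotoneOn Γ₃ (Set.Ioc 0 ℓ₃) ∧
      ∀ β : ℝ, β₃ ≤ β → ∀ (x : Fin 4 → ℤ) (R₀ : ℕ), R₀ ∈ S → ((2 * R₀ + 1 : ℕ) : ℝ) * a β ≤ ℓ₃ →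
        ∀ (η : LGConfig 4 G) (n : ℕ) (y z : Fin 4 → ℤ), 0 < (n : ℝ) * a β →
          n₃ ≤ n → ‖siteToE (y - x) - (n : ℝ) • v‖ ≤ δ * n → ‖siteToE (z - x) - (n : ℝ) • w‖ ≤ δ * n →
            K₃ ((n : ℝ) * a β) * n ≤ depth (fun j => x j - R₀) (2 * R₀ + 1) x →
            K₃ ((n : ℝ) * a β) * n ≤ depth (fun j => x j - R₀) (2 * R₀ + 1) y →
            K₃ ((n : ℝ) * a β) * n ≤ depth (fun j => x j - R₀) (2 * R₀ + 1) z →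
              c₃ * Γ₃ ((n : ℝ) * a β) ≤
                σ * (n : ℝ) ^ 12 * kerK3 G r β (fun j => x j - R₀) (2 * R₀ + 1) η x y z) :
    ∃ (v w : EuclideanSpace ℝ (Fin 4)) (σ δ : ℝ) (Γ₃ : ℝ → ℝ) (β₃ ℓ₃ c₃ : ℝ) (K₃ : ℝ → ℝ) (n₃ : ℕ),
      (σ = 1 ∨ σ = -1) ∧ 0 < δ ∧ 2 * δ < ‖v‖ ∧ 2 * δ < ‖w‖ ∧ 2 * δ < ‖v - w‖ ∧ 0 < ℓ₃ ∧ 0 < c₃ ∧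
      (∀ s, 1 ≤ K₃ s) ∧ Tendsto (fun s : ℝ => s * K₃ s) (nhdsWithin 0 (Set.Ioi 0)) (nhds 0) ∧
      Tendsto (fun s : ℝ => Γ₃ s / s ^ 4) (nhdsWithin 0 (Set.Ioi 0)) atTop ∧
      ∀ β : ℝ, β₃ ≤ β → ∀ (x : Fin 4 → ℤ) (R : ℕ), ((2 * R + 1 : ℕ) : ℝ) * a β ≤ ℓ₃ →
        ∀ (η : LGConfig 4 G) (n : ℕ) (y z : Fin 4 → ℤ) (s₀ : ℝ), 0 < s₀ → s₀ ≤ (n : ℝ) * a β →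
          n₃ ≤ n → ‖siteToE (y - x) - (n : ℝ) • v‖ ≤ δ * n → ‖siteToE (z - x) - (n : ℝ) • w‖ ≤ δ * n →
            K₃ s₀ * n ≤ depth (fun j => x j - R) (2 * R + 1) x →
            K₃ s₀ * n ≤ depth (fun j => x j - R) (2 * R + 1) y →
            K₃ s₀ * n ≤ depth (fun j => x j - R) (2 * R + 1) z →
              c₃ * Γ₃ ((n : ℝ) * a β) ≤
                σ * (n : ℝ) ^ 12 * kerK3 G r β (fun j => x j - R) (2 * R + 1) η x y z :=
  fc3Weak_of_antitoneCollar G r a (fc3Weak_of_cover G r a ha hFBL S θ hθ D hcover h)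

/-- **The weak third-cumulant clause (T) along a geometric sequence of radii.**  If the signed conditional
third-cumulant floor holds on the x-centred femto cubes of radii `R_k` (unbounded, `R_{k+1} + 1 ≤ θ (R_k + 1)`,
`θ ≥ 1`), with an antitone collar and a positive monotone shape with growth `Γ₃(s)/s⁴ → ∞`, then — given `FBL G r a`
— the registered clause (T) holds (constant `c₃/2`). [folklore] -/
theorem fc3Weak_of_seq (ha : ∀ β, 0 < a β) (hFBL : FBL G r a) (Rs : ℕ → ℕ) (θ : ℝ) (hθ : 1 ≤ θ)
    (hgap : ∀ k, (Rs (k + 1) : ℝ) + 1 ≤ θ * ((Rs k : ℝ) + 1)) (hunb : ∀ R : ℕ, ∃ k, R < Rs k)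
    (h : ∃ (v w : EuclideanSpace ℝ (Fin 4)) (σ δ : ℝ) (Γ₃ : ℝ → ℝ) (β₃ ℓ₃ c₃ : ℝ) (K₃ : ℝ → ℝ) (n₃ : ℕ),
      (σ = 1 ∨ σ = -1) ∧ 0 < δ ∧ 2 * δ < ‖v‖ ∧ 2 * δ < ‖w‖ ∧ 2 * δ < ‖v - w‖ ∧ 0 < ℓ₃ ∧ 0 < c₃ ∧
      (∀ s, 1 ≤ K₃ s) ∧ AntitoneOn K₃ (Set.Ioi 0) ∧
      Tendsto (fun s : ℝ => s * K₃ s) (nhdsWithin 0 (Set.Ioi 0)) (nhds 0) ∧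
      Tendsto (fun s : ℝ => Γ₃ s / s ^ 4) (nhdsWithin 0 (Set.Ioi 0)) atTop ∧
      (∀ s : ℝ, 0 < s → s ≤ ℓ₃ → 0 < Γ₃ s) ∧ MonotoneOn Γ₃ (Set.Ioc 0 ℓ₃) ∧
      ∀ β : ℝ, β₃ ≤ β → ∀ (x : Fin 4 → ℤ) (k : ℕ), ((2 * Rs k + 1 : ℕ) : ℝ) * a β ≤ ℓ₃ →
        ∀ (η : LGConfig 4 G) (n : ℕ) (y z : Fin 4 → ℤ), 0 < (n : ℝ) * a β →
          n₃ ≤ n → ‖siteToE (y - x) - (n : ℝ) • v‖ ≤ δ * n → ‖siteToE (z - x) - (n : ℝ) • w‖ ≤ δ * n →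
            K₃ ((n : ℝ) * a β) * n ≤ depth (fun j => x j - Rs k) (2 * Rs k + 1) x →
            K₃ ((n : ℝ) * a β) * n ≤ depth (fun j => x j - Rs k) (2 * Rs k + 1) y →
            K₃ ((n : ℝ) * a β) * n ≤ depth (fun j => x j - Rs k) (2 * Rs k + 1) z →
              c₃ * Γ₃ ((n : ℝ) * a β) ≤
                σ * (n : ℝ) ^ 12 * kerK3 G r β (fun j => x j - Rs k) (2 * Rs k + 1) η x y z) :
    ∃ (v w : EuclideanSpace ℝ (Fin 4)) (σ δ : ℝ) (Γ₃ : ℝ → ℝ) (β₃ ℓ₃ c₃ : ℝ) (K₃ : ℝ → ℝ) (n₃ : ℕ),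
      (σ = 1 ∨ σ = -1) ∧ 0 < δ ∧ 2 * δ < ‖v‖ ∧ 2 * δ < ‖w‖ ∧ 2 * δ < ‖v - w‖ ∧ 0 < ℓ₃ ∧ 0 < c₃ ∧
      (∀ s, 1 ≤ K₃ s) ∧ Tendsto (fun s : ℝ => s * K₃ s) (nhdsWithin 0 (Set.Ioi 0)) (nhds 0) ∧
      Tendsto (fun s : ℝ => Γ₃ s / s ^ 4) (nhdsWithin 0 (Set.Ioi 0)) atTop ∧
      ∀ β : ℝ, β₃ ≤ β → ∀ (x : Fin 4 → ℤ) (R : ℕ), ((2 * R + 1 : ℕ) : ℝ) * a β ≤ ℓ₃ →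
        ∀ (η : LGConfig 4 G) (n : ℕ) (y z : Fin 4 → ℤ) (s₀ : ℝ), 0 < s₀ → s₀ ≤ (n : ℝ) * a β →
          n₃ ≤ n → ‖siteToE (y - x) - (n : ℝ) • v‖ ≤ δ * n → ‖siteToE (z - x) - (n : ℝ) • w‖ ≤ δ * n →
            K₃ s₀ * n ≤ depth (fun j => x j - R) (2 * R + 1) x →
            K₃ s₀ * n ≤ depth (fun j => x j - R) (2 * R + 1) y →
            K₃ s₀ * n ≤ depth (fun j => x j - R) (2 * R + 1) z →
              c₃ * Γ₃ ((n : ℝ) * a β) ≤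
                σ * (n : ℝ) ^ 12 * kerK3 G r β (fun j => x j - R) (2 * R + 1) η x y z := by
  obtain ⟨v, w, σ, δ, Γ₃, β₃, ℓ₃, c₃, K₃, n₃, hσ, hδ, hv, hw, hvw, hℓ₃, hc₃, hK1, hKanti, hKlim, hΓlim, hΓpos, hΓmono,
    H⟩ := h
  refine fc3Weak_of_cover' G r a ha hFBL (Set.range Rs) θ hθ (Rs 0) (cover_of_seq Rs θ hgap hunb)
    ⟨v, w, σ, δ, Γ₃, β₃, ℓ₃, c₃, K₃, n₃, hσ, hδ, hv, hw, hvw, hℓ₃, hc₃, hK1, hKanti, hKlim, hΓlim, hΓpos, hΓmono, ?_⟩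
  intro β hβ x R₀ hR₀ hb η n y z hs hn hy hz hKx hKy hKz
  obtain ⟨k, rfl⟩ := hR₀
  exact H β hβ x k hb η n y z hs hn hy hz hKx hKy hKz

end Lattice

end Summit.QuantumFields.YangMills.Cruxes.NT.WeakPackage

end
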